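import Summits.ABC.ABC.Theorems.DeepRegimeABC.Negative.CensusChecker

/-!
# `DeepRegimeABC` (stmt-ABC-15121): kernel-checkable census of the deep cells below `10⁷`

Compute-certificate for the crux `Summit.ABC.ABC.Theses.IneffectiveSubspace.DeepRegimeABC`
(abc with exponent `1 + ε` on the `ε`-dependent deep tail `{ω₅(abc) ≥ K(ε)}`,
`ω₅(n) := #{p : p⁵ ∣ n}`), refuter compute seat `ccert-stmt-ABC-15121` (2026-08-16), using the
soundness-proved checker `censusCheck` of `Negative/CensusChecker.lean`.

**Certified here** (the only computation trusted to the compiler is the closed `Bool` equation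
`censusCheck … = true` and the quality comparison on eight listed triples — `native_decide`,
certificate lane D-0022; everything else is kernel-checked):

* `deepFour_hits_le_ten_pow_seven` — every abc triple `a + b = c ≤ 10⁷` with `ω₅(abc) ≥ 4` and
  `rad(abc) < c` is one of the EIGHT triples of `deepFourHits` (up to the order of `a, b`);
* `deepFive_no_hit_le_ten_pow_seven` — no abc triple with `c ≤ 10⁷` and `ω₅(abc) ≥ 5` has
  `rad(abc) < c`: the cells `ω₅ ≥ 5` hold no abc hit below `10⁷`;
* `deepFour_pow_lt_le_ten_pow_seven`, `deepFour_constFreeCell_le_ten_pow_seven` — quality `< 1.345`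
  on the cell `ω₅ ≥ 4` below `10⁷` (record `(2890625, 6067327, 8957952)`, `q = 1.34493…`), i.e. the
  constant-free cell statement `ConstFreeCell(4, ε)` of `Negative/ConstFreeFloors` holds below `10⁷`
  for every `ε ≥ 0.345`; `deepFive_constFreeCell_le_ten_pow_seven` — `ConstFreeCell(K, ε)` holds
  below `10⁷` for all `K ≥ 5`, `ε > 0`.

This matches the informal two-radical census `Cruxes/DepthUniformity/Census-r1-k2.md` (kit j015304:
the cells `ω₅ = 0, 1, 2, 3, 4` of the 3504 abc hits with `c ≤ 10⁷` hold `170/1323/1598/405/8` hits) and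
the lattice census `deep_census.py` of this seat (CERT.md).  All the obstructions to small thresholds
recorded in `Negative/ConstFreeFloors` (Reyssat, Browkin–Brzeziński, Nitaj: `K₁(ε) ≥ 3, 4, 5` for
`ε ≤ 0.6299, 0.6234, 0.5221`) live above `10⁷`.
-/

-- `Summit.<Summit>.<Problem>` is the mandated summit-side namespace (CONVENTIONS §2); for the
-- single-conjunct summit `ABC` the two coincide, so the duplicate `ABC.ABC` is deliberate.
set_option linter.dupNamespace false

namespace Summit.ABC.ABC.Theorems.DeepRegimeABC.Negative

open Literature.NumberTheory.DiophantineGeometry UniqueFactorizationMonoid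

/-! ## The certificates below `10⁷` -/

/-- The primes `p` with `p⁵ ≤ 10⁷`, i.e. `p ≤ 25`. [folklore] -/
def primesFifthLe : List ℕ := [2, 3, 5, 7, 11, 13, 17, 19, 23]

/-- `primesFifthLe` is duplicate-free. [folklore] -/
theorem primesFifthLe_nodup : primesFifthLe.Nodup := by decide

/-- Every prime `p` with `p⁵ ≤ 10⁷` is in `primesFifthLe`. [folklore] -/
theorem mem_primesFifthLe {p : ℕ} (hp : p.Prime) (h : p ^ 5 ≤ 10 ^ 7) : p ∈ primesFifthLe := by
  have hp26 : p < 26 := by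
    by_contra h'
    have h26 : 26 ≤ p := not_lt.mp h'
    have := Nat.pow_le_pow_left h26 5
    omega
  interval_cases p <;> first | decide | exact absurd hp (by decide)

/-- The eight abc hits with `ω₅(abc) ≥ 4` below `10⁷` (ordered `a < b`), by quality:
`(2890625, 6067327, 8957952)` `[5⁷·37 + 7⁵·19² = 2¹²·3⁷]`, q `1.3449`;
`(3200000, 5858973, 9058973)` `[2¹⁰·5⁵ + 3⁸·19·47 = 7⁷·11]`, q `1.1018`;
`(823543, 1676457, 2500000)` `[7⁷ + 3⁵·6899 = 2⁵·5⁷]`, q `1.0385`;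
`(823543, 2815625, 3639168)` `[7⁷ + 5⁵·17·53 = 2⁷·3⁷·13]`, q `1.0266`;
`(31104, 890771, 921875)` `[2⁷·3⁵ + 7⁵·53 = 5⁶·59]`, q `1.0253`;
`(30976, 4053125, 4084101)` `[2⁸·11² + 3·5⁵·... ]`, q `1.0208`;
`(303264, 6436343, 6739607)` `[2⁵·3⁶·13 + 23⁵ = 7⁵·401]`, q `1.0189`;
`(3125, 4302592, 4305717)` `[5⁵ + 2⁸·7⁵ = 3⁵·13·29·47]`, q `1.0096`
(Census-r1-k2, kit j015304; re-derived by deep_census.py). [folklore] -/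
def deepFourHits : List (ℕ × ℕ × ℕ) :=
  [(2890625, 6067327, 8957952), (3200000, 5858973, 9058973), (823543, 1676457, 2500000),
   (823543, 2815625, 3639168), (31104, 890771, 921875), (30976, 4053125, 4084101),
   (303264, 6436343, 6739607), (3125, 4302592, 4305717)]

/-- **Certificate run, depth 4, `N = 10⁷`** (compiled evaluation of the checker). [folklore] -/
theorem censusCheck_four_ten_pow_seven :
    censusCheck 4 (10 ^ 7) primesFifthLe deepFourHits = true := by
  native_decide

/-- **Certificate run, depth 5, `N = 10⁷`, empty list.** [folklore] -/
theorem censusCheck_five_ten_pow_seven :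
    censusCheck 5 (10 ^ 7) primesFifthLe [] = true := by
  native_decide

/-- **Census of the cell `ω₅ ≥ 4` below `10⁷`.** Every abc triple `a + b = c ≤ 10⁷` with at least
four primes `p⁵ ∣ abc` and `rad(abc) < c` is one of the eight triples of `deepFourHits`, up to the
order of `a` and `b`. [folklore] -/
theorem deepFour_hits_le_ten_pow_seven {a b c : ℕ} (habc : IsABCTriple a b c) (hc : c ≤ 10 ^ 7)
    (hK : 4 ≤ ((a * b * c).primeFactors.filter (fun p => 5 ≤ (a * b * c).factorization p)).card)
    (hhit : rad a b c < c) : (a, b, c) ∈ deepFourHits ∨ (b, a, c) ∈ deepFourHits :=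
  census_sound' 4 (10 ^ 7) primesFifthLe deepFourHits primesFifthLe_nodup
    (fun _ hp h => mem_primesFifthLe hp h) censusCheck_four_ten_pow_seven habc hc hK hhit

/-- **The cells `ω₅ ≥ 5` hold no abc hit below `10⁷`**: every abc triple `a + b = c ≤ 10⁷` with at
least five primes `p⁵ ∣ abc` has `c ≤ rad(abc)` (quality `≤ 1`). [folklore] -/
theorem deepFive_no_hit_le_ten_pow_seven {a b c : ℕ} (habc : IsABCTriple a b c) (hc : c ≤ 10 ^ 7)
    (hK : 5 ≤ ((a * b * c).primeFactors.filter (fun p => 5 ≤ (a * b * c).factorization p)).card) :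
    c ≤ rad a b c := by
  by_contra hlt
  rcases census_sound' 5 (10 ^ 7) primesFifthLe [] primesFifthLe_nodup
    (fun _ hp h => mem_primesFifthLe hp h) censusCheck_five_ten_pow_seven habc hc hK
    (not_le.mp hlt) with h | h <;> simp at h

/-! ## Quality on the deep cells below `10⁷` -/

/-- Each of the eight listed hits has `c¹⁰⁰⁰ < (rad a · rad b · rad c)¹³⁴⁵`, i.e. quality `< 1.345`
(the record is `(2890625, 6067327, 8957952)`, quality `1.34493…`; compiled evaluation). [folklore] -/
theorem deepFourHits_pow_lt :
    deepFourHits.all (fun x => decide (x.2.2 ^ 1000 < (radC x.1 * radC x.2.1 * radC x.2.2) ^ 1345))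
      = true := by
  native_decide

set_option exponentiation.threshold 2000 in
/-- **Quality `< 1.345` on the cell `ω₅ ≥ 4` below `10⁷`** (integer form): every abc triple
`a + b = c ≤ 10⁷` with `ω₅(abc) ≥ 4` has `c¹⁰⁰⁰ < rad(abc)¹³⁴⁵`. [folklore] -/
theorem deepFour_pow_lt_le_ten_pow_seven {a b c : ℕ} (habc : IsABCTriple a b c) (hc : c ≤ 10 ^ 7)
    (hK : 4 ≤ ((a * b * c).primeFactors.filter (fun p => 5 ≤ (a * b * c).factorization p)).card) :
    c ^ 1000 < rad a b c ^ 1345 := by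
  have hc2 : 2 ≤ c := by obtain ⟨ha, hb, hsum, -⟩ := habc; omega
  by_cases hhit : rad a b c < c
  · have hall := List.all_eq_true.mp deepFourHits_pow_lt
    rcases deepFour_hits_le_ten_pow_seven habc hc hK hhit with hm | hm
    · have := of_decide_eq_true (hall _ hm)
      simpa [radC_mul_three habc] using this
    · have := of_decide_eq_true (hall _ hm)
      obtain ⟨ha, hb, hsum, hcop⟩ := habc
      have habc' : IsABCTriple b a c := ⟨hb, ha, by omega, hcop.symm⟩
      have hsw : rad b a c = rad a b c := by rw [rad_def, rad_def, mul_comm b a]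
      simpa [radC_mul_three habc', hsw] using this
  · have hle : c ≤ rad a b c := not_lt.mp hhit
    calc c ^ 1000 ≤ rad a b c ^ 1000 := Nat.pow_le_pow_left hle _
      _ < rad a b c ^ 1345 := Nat.pow_lt_pow_right (by omega) (by norm_num)

/-- From `c^Q < R^P` (naturals, `0 < Q`) to `c < R^(P/Q)` in `ℝ`. [folklore] -/
theorem cast_lt_rpow_of_pow_lt_pow {c R P Q : ℕ} (hQ : 0 < Q) (h : c ^ Q < R ^ P) :
    (c : ℝ) < (R : ℝ) ^ ((P : ℝ) / Q) := by
  have hc0 : (0 : ℝ) ≤ c := Nat.cast_nonneg _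
  have hR0 : (0 : ℝ) ≤ R := Nat.cast_nonneg _
  have hQR : (0 : ℝ) < Q := by exact_mod_cast hQ
  have h1 : ((c : ℝ) ^ (Q : ℝ)) < ((R : ℝ) ^ ((P : ℝ) / Q)) ^ (Q : ℝ) := by
    rw [← Real.rpow_mul hR0, div_mul_cancel₀ _ hQR.ne', Real.rpow_natCast, Real.rpow_natCast]
    exact_mod_cast h
  exact lt_of_pow_lt_pow_left₀ _ (Real.rpow_nonneg hR0 _) (by
    simpa [Real.rpow_natCast] using h1)

/-- **The constant-free cell statement `ConstFreeCell(4, ε)` holds below `10⁷` for every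
`ε ≥ 0.345`**: every abc triple `a + b = c ≤ 10⁷` with `ω₅(abc) ≥ 4` has `c < rad(abc)^(1+ε)`.
(Compare `Negative/ConstFreeFloors`: Nitaj's triple, `c ≈ 5·10¹⁵`, refutes `ConstFreeCell(4, ε)` for
`ε ≤ 0.5221` — the obstruction lives above `10⁷`.) [folklore] -/
theorem deepFour_constFreeCell_le_ten_pow_seven {ε : ℝ} (hε : 0.345 ≤ ε) {a b c : ℕ}
    (habc : IsABCTriple a b c) (hc : c ≤ 10 ^ 7)
    (hK : 4 ≤ ((a * b * c).primeFactors.filter (fun p => 5 ≤ (a * b * c).factorization p)).card) :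
    (c : ℝ) < ((rad a b c : ℕ) : ℝ) ^ (1 + ε) := by
  have h := cast_lt_rpow_of_pow_lt_pow (by norm_num) (deepFour_pow_lt_le_ten_pow_seven habc hc hK)
  have hrad1 : (1 : ℝ) ≤ ((rad a b c : ℕ) : ℝ) := by
    rw [rad_def]; exact_mod_cast Nat.radical_pos _
  calc (c : ℝ) < ((rad a b c : ℕ) : ℝ) ^ (((1345 : ℕ) : ℝ) / (1000 : ℕ)) := h
    _ ≤ ((rad a b c : ℕ) : ℝ) ^ (1 + ε) :=
        Real.rpow_le_rpow_of_exponent_le hrad1 (by norm_num at hε ⊢; linarith)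

/-- **`ConstFreeCell(K, ε)` holds below `10⁷` for every `K ≥ 5` and every `ε > 0`**: an abc triple
`a + b = c ≤ 10⁷` with `ω₅(abc) ≥ 5` has `c ≤ rad(abc)`, hence `c < rad(abc)^(1+ε)`. [folklore] -/
theorem deepFive_constFreeCell_le_ten_pow_seven {ε : ℝ} (hε : 0 < ε) {a b c : ℕ}
    (habc : IsABCTriple a b c) (hc : c ≤ 10 ^ 7)
    (hK : 5 ≤ ((a * b * c).primeFactors.filter (fun p => 5 ≤ (a * b * c).factorization p)).card) :
    (c : ℝ) < ((rad a b c : ℕ) : ℝ) ^ (1 + ε) := by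
  have hle := deepFive_no_hit_le_ten_pow_seven habc hc hK
  have hc2 : 2 ≤ c := by obtain ⟨ha, hb, hsum, -⟩ := habc; omega
  have hrad1 : (1 : ℝ) < ((rad a b c : ℕ) : ℝ) := by exact_mod_cast (lt_of_lt_of_le (by norm_num) (hc2.trans hle))
  calc (c : ℝ) ≤ ((rad a b c : ℕ) : ℝ) := by exact_mod_cast hle
    _ = ((rad a b c : ℕ) : ℝ) ^ (1 : ℝ) := (Real.rpow_one _).symm
    _ < ((rad a b c : ℕ) : ℝ) ^ (1 + ε) := Real.rpow_lt_rpow_of_exponent_lt hrad1 (by linarith)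

end Summit.ABC.ABC.Theorems.DeepRegimeABC.Negative
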